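import Mathlib

/-!
# Ventures/CertifiedManyBodySolver — Conjectures/HingeKink.lean: the KINK LEMMA and the ROBIN DICTIONARY of **T-M1D.45**
# (the shell law C-M1D-22 of the one-body window value is a theorem), TYPED AND PROVED

HONEST FRAMING: first certified bounds; not a superconductivity verdict; every number certified or labelled float.

Source: `HOME/sr-mbsolver-m1-4/structure/design/SHELL-LAW-THEOREM.md` (sha16 8555680d969bb55a; sr-mbsolver-m1-4 gen 16, 2026-08-25),
§3.3 (Lemma 3) and §3.9 (Lemma 8 (i), (iii)); `structure/shells/SHELL-LAW.md` §3 (the law) and §16.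

THE THEOREM IN WORDS (paper-level, not formalised here). In the variable `c = cos q` the one-body N-representability problem on an
`n`-site window — maximise `∫ c dμ` over pairs of positive measures `(μ, σ)` on `[-1, 1]` with `μ + σ` a positive quadrature exact on
polynomials of degree `≤ n - 1` for the arcsine law and `|μ| = ν` — has the linear-programming dual 'minimise `K ν + ∫ q dw` over real
`K` and polynomials `q` of degree `≤ n - 1` with `q ≥ max 0 (c - K)` on `[-1, 1]`' (one-sided approximation of the HINGE from above).
Three facts decide it: (1) the KINK LEMMA below — a function differentiable at `K` that lies above the hinge `max 0 (c - K)` near `K`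
cannot vanish at `K`; applied to the optimal dual polynomial it says that `K` is never a quadrature node, so by complementary slackness
the optimal `μ` consists of WHOLE atoms of the optimal quadrature (the 'Fermi sea swallows whole nodes'); (2) a Rolle count bounding the
number of contacts; (3) the classification of minimal / next-to-minimal positive quadratures of the arcsine weight as quasi-orthogonal
Gauss / Radau / Lobatto–Chebyshev rules, whose node equations `T_{r+1} = g T_r`, `V_r = g V_{r-1}`, `U_r + a U_{r-1} = 0`,
`W_r + a W_{r-1} = 0` are — by the two trigonometric identities `robin_phi_identity`, `robin_psi_identity` below, read at `x = k/2` —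
exactly the ROBIN equations `tan(nk/2) tan(k/2) = λ` and `tan(nk/2) cot(k/2) = λ` of the shell law, with `g = (1-λ)/(1+λ)`,
`a = (1+λ)/(1-λ)`; the weight of the atom at `q = 0` comes out as `1/(n - λ)` by the algebraic identities `weight_zero_odd`,
`weight_zero_even` (from `∫ (1+c) U_j dw = 1`, `∫ W_j dw = 1`, `U_j(1) = j+1`, `W_j(1) = 2j+1`).

WHAT IS TYPED AND PROVED HERE (the formal content is exactly these statements; nothing about the Hubbard chain is asserted):
* `kink` — if `q : ℝ → ℝ` has a derivative at `K`, `0 ≤ q c` for `c < K` near `K`, and `c - K ≤ q c` for `c > K` near `K`, then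
  `q K ≠ 0` (the one-sided difference quotients force `q' ≤ 0` and `q' ≥ 1`).  `kink_of_hinge_le` — the same with the single
  hypothesis `max 0 (c - K) ≤ q c` near `K`.
* `robin_phi_identity`, `robin_psi_identity` — `(1+λ) cos((n+1)x) - (1-λ) cos((n-1)x) = 2 (λ cos(nx) cos x - sin(nx) sin x)` and
  `(1-λ) sin((n+1)x) + (1+λ) sin((n-1)x) = 2 (sin(nx) cos x - λ cos(nx) sin x)` for all real `n, x, λ`; and the equivalences
  `robin_phi_iff`, `robin_psi_iff`: where `cos(nx) cos x ≠ 0` (resp. `cos(nx) sin x ≠ 0`), `tan(nx) tan x = λ ↔ (1+λ) cos((n+1)x) =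
  (1-λ) cos((n-1)x)` and `tan(nx) / tan x = λ ↔ (1-λ) sin((n+1)x) + (1+λ) sin((n-1)x) = 0`.
* `weight_zero_odd`, `weight_zero_even` — for `λ ≠ 1` and `a = (1+λ)/(1-λ)`: `(1 + a) (2r+1-λ) = 2 ((r+1) + a r)` and
  `(1 + a) (2r - λ) = (2r+1) + a (2r-1)`, i.e. the `q = 0` Christoffel number `(1+a)/h(1)` equals `1/(n-λ)` for `n = 2r+1`, `2r`.
-/

namespace Summit.Ventures.CertifiedManyBodySolver.Conjectures.HingeKink

open Filter Topology

/-- KINK LEMMA (T-M1D.45, Lemma 3; abstract form). A function with a derivative at `K` which is `≥ 0` just left of `K` and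
`≥ c - K` just right of `K` does not vanish at `K`: a differentiable majorant of the hinge `max 0 (c - K)` never touches it at the kink. -/
theorem kink {q : ℝ → ℝ} {q' K : ℝ} (hq : HasDerivAt q q' K)
    (hleft : ∀ᶠ c in 𝓝[<] K, 0 ≤ q c) (hright : ∀ᶠ c in 𝓝[>] K, c - K ≤ q c) : q K ≠ 0 := by
  intro h0
  obtain ⟨hL, hR⟩ := hasDerivAt_iff_tendsto_slope_left_right.mp hq
  -- from the right the difference quotients are ≥ 1
  have hge : (1 : ℝ) ≤ q' := by
    refine ge_of_tendsto hR ?_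
    filter_upwards [hright, self_mem_nhdsWithin] with c hc hcK
    have hpos : 0 < c - K := sub_pos.mpr hcK
    rw [slope_def_field, h0, sub_zero]
    exact (le_div_iff₀ hpos).mpr (by simpa using hc)
  -- from the left the difference quotients are ≤ 0
  have hle : q' ≤ 0 := by
    refine le_of_tendsto hL ?_
    filter_upwards [hleft, self_mem_nhdsWithin] with c hc hcK
    have hneg : c - K ≤ 0 := sub_nonpos.mpr (le_of_lt hcK)
    rw [slope_def_field, h0, sub_zero]
    exact div_nonpos_of_nonneg_of_nonpos hc hneg
  linarith

/-- The kink lemma with the single hypothesis '`q` majorises the hinge near `K`'. -/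
theorem kink_of_hinge_le {q : ℝ → ℝ} {q' K : ℝ} (hq : HasDerivAt q q' K)
    (hmaj : ∀ᶠ c in 𝓝 K, max 0 (c - K) ≤ q c) : q K ≠ 0 := by
  refine kink hq ?_ ?_
  · exact (hmaj.filter_mono nhdsWithin_le_nhds).mono fun c hc => le_trans (le_max_left _ _) hc
  · exact (hmaj.filter_mono nhdsWithin_le_nhds).mono fun c hc => le_trans (le_max_right _ _) hc

/-- ROBIN DICTIONARY, even modes (T-M1D.45 Lemma 8 (i)): the identity behind
`tan(nk/2) tan(k/2) = λ ⟺ (1+λ) cos((n+1)k/2) = (1-λ) cos((n-1)k/2)` (i.e. `T_{r+1} = g T_r`, `V_r = g V_{r-1}`). -/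
theorem robin_phi_identity (n x lam : ℝ) :
    (1 + lam) * Real.cos ((n + 1) * x) - (1 - lam) * Real.cos ((n - 1) * x)
      = 2 * (lam * Real.cos (n * x) * Real.cos x - Real.sin (n * x) * Real.sin x) := by
  rw [show (n + 1) * x = n * x + x by ring, show (n - 1) * x = n * x - x by ring, Real.cos_add, Real.cos_sub]
  ring

/-- ROBIN DICTIONARY, odd modes (T-M1D.45 Lemma 8 (i)): the identity behind
`tan(nk/2) cot(k/2) = λ ⟺ (1-λ) sin((n+1)k/2) + (1+λ) sin((n-1)k/2) = 0` (i.e. `U_r + a U_{r-1} = 0`, `W_r + a W_{r-1} = 0`). -/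
theorem robin_psi_identity (n x lam : ℝ) :
    (1 - lam) * Real.sin ((n + 1) * x) + (1 + lam) * Real.sin ((n - 1) * x)
      = 2 * (Real.sin (n * x) * Real.cos x - lam * Real.cos (n * x) * Real.sin x) := by
  rw [show (n + 1) * x = n * x + x by ring, show (n - 1) * x = n * x - x by ring, Real.sin_add, Real.sin_sub]
  ring

/-- Even modes: away from the poles, the Robin equation `tan(nx) tan x = λ` IS the quasi-orthogonality relation. -/
theorem robin_phi_iff {n x lam : ℝ} (hc : Real.cos (n * x) ≠ 0) (hc' : Real.cos x ≠ 0) :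
    Real.tan (n * x) * Real.tan x = lam ↔
      (1 + lam) * Real.cos ((n + 1) * x) = (1 - lam) * Real.cos ((n - 1) * x) := by
  have key := robin_phi_identity n x lam
  rw [Real.tan_eq_sin_div_cos, Real.tan_eq_sin_div_cos, div_mul_div_comm, div_eq_iff (mul_ne_zero hc hc')]
  constructor
  · intro h
    have h' : (1 + lam) * Real.cos ((n + 1) * x) - (1 - lam) * Real.cos ((n - 1) * x) = 0 := by
      rw [key]; linear_combination (-2 : ℝ) * h
    linarith
  · intro h
    have h' : (1 + lam) * Real.cos ((n + 1) * x) - (1 - lam) * Real.cos ((n - 1) * x) = 0 := by linarith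
    rw [key] at h'
    linear_combination (-1 / 2 : ℝ) * h'

/-- Odd modes: away from the poles and zeros, the Robin equation `tan(nx) / tan x = λ` IS the quasi-orthogonality relation. -/
theorem robin_psi_iff {n x lam : ℝ} (hc : Real.cos (n * x) ≠ 0) (hs : Real.sin x ≠ 0) :
    Real.tan (n * x) / Real.tan x = lam ↔
      (1 - lam) * Real.sin ((n + 1) * x) + (1 + lam) * Real.sin ((n - 1) * x) = 0 := by
  have key := robin_psi_identity n x lam
  have e : Real.tan (n * x) / Real.tan x = (Real.sin (n * x) * Real.cos x) / (Real.cos (n * x) * Real.sin x) := by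
    rw [Real.tan_eq_sin_div_cos, Real.tan_eq_sin_div_cos, div_div_div_eq]
  rw [e, div_eq_iff (mul_ne_zero hc hs)]
  constructor
  · intro h
    rw [key]; linear_combination (2 : ℝ) * h
  · intro h
    rw [key] at h
    linear_combination (1 / 2 : ℝ) * h

/-- The `q = 0` Christoffel number for odd `n = 2r+1` (T-M1D.45 Lemma 8 (iii)): with `a = (1+λ)/(1-λ)` and `h = (1+c)(U_r + a U_{r-1})`,
`w₀ · h(1) = ∫ h dw = 1 + a` and `h(1) = 2((r+1) + a r)` give `w₀ = 1/(n - λ)`; here is the identity `(1+a)(n-λ) = h(1)`. -/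
theorem weight_zero_odd (r lam : ℝ) (hlam : lam ≠ 1) :
    (1 + (1 + lam) / (1 - lam)) * ((2 * r + 1) - lam) = 2 * ((r + 1) + (1 + lam) / (1 - lam) * r) := by
  have h1 : (1 - lam) ≠ 0 := sub_ne_zero.mpr (Ne.symm hlam)
  field_simp
  ring

/-- The `q = 0` Christoffel number for even `n = 2r` (T-M1D.45 Lemma 8 (iii)): with `h = W_r + a W_{r-1}`, `w₀ · h(1) = 1 + a`,
`h(1) = (2r+1) + a(2r-1)`, so `w₀ = 1/(n - λ)`; here is the identity `(1+a)(n-λ) = h(1)`. -/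
theorem weight_zero_even (r lam : ℝ) (hlam : lam ≠ 1) :
    (1 + (1 + lam) / (1 - lam)) * (2 * r - lam) = (2 * r + 1) + (1 + lam) / (1 - lam) * (2 * r - 1) := by
  have h1 : (1 - lam) ≠ 0 := sub_ne_zero.mpr (Ne.symm hlam)
  field_simp
  ring

end Summit.Ventures.CertifiedManyBodySolver.Conjectures.HingeKink
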